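import Summits.ResolutionOfSingularities.ResolutionOfSingularities.Theorems.PurelyInseparableDim4Equivariance
import HarnessLib

/-!
# [OURS · res-dim4-pi] A recurrence UP TO RENAMING is a non-termination certificate: from `s ⟶⁺ s.rename e`
  an infinite branch is built (the soundness of cycle detection modulo S₄ for the equivariant relations)

Cell `res-dim4-pi` (D-0157 DOOR 2, wave 2), seat `res-dim4-p-6`; sequel of `PurelyInseparableDim4Equivariance`
(`step1h_rename`, `step0_rename`, `step2_rename`, `stepHP_rename`, `stepRule_rename`).  The engines detect
«literal recurrence» of presented states, and engine B memoises states UP TO S₄ (desk WORD #25 (a) / #26 (a):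
«cycles mod S₄»).  THIS FILE says when that is a certificate: for every step RELATION that is equivariant under
a map `g` (here: renaming by a permutation `e`), a finite path from `s` to `g s` unrolls into an INFINITE branch
from `s` — the `k`-th lap is the `g^k`-image of the first.  The literal cycle (`g = id`) is the special case
every specimen file builds by hand.

* §1 (pure logic, any type) `rel_iterate` and **`exists_chain_of_transGen_apply`**: if `ρ a b → ρ (g a) (g b)` and
  `TransGen ρ a (g a)`, then some `c : ℕ → α` has `c 0 = a` and `ρ (c m) (c (m+1))` for all `m`;
  `exists_chain_of_transGen_self` (the literal cycle).
* §2 (cell words) **`exists_branch_of_step1h_transGen_rename`** and the same for `Step0`, `Step2`, `StepHP`, and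
  for `StepRule R` with `R` equivariant; hence **`not_terminates1h_of_transGen_rename`**: a MODE-1h path from a
  state to one of its renamings, over ONE field of characteristic `p`, refutes `Terminates1h p q` — a cycle
  «mod S₄» found by an engine is a valid kill for the relations of record (all ties followed), exactly as a
  literal cycle is (`not_terminates1h_of_transGen_self`).

Scope (honest): the unrolled branch follows the RELATION (any tie may be taken at each step); it says nothing
about a particular non-equivariant rule (cf. `PurelyInseparableDim4NoEquivariantMode1h`).  [OURS · counted 0 ·
elementary · AI kernel work, weaker than expert review.]  NOTHING here is a statement about resolution of
singularities; resolution in dimension `≥ 4` / characteristic `p > 0` is NOT proved by anything in this file.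
bears_on: LADDER-RESOLUTION:D157-DOOR2 (res-dim4-pi · EQUIVARIANCE).  Host item (DR-157-C): `stmt-ResolutionOfSingularities-16155`.
-/

noncomputable section

set_option linter.dupNamespace false -- mandated namespace of this single-conjunct summit

namespace Summit.ResolutionOfSingularities.ResolutionOfSingularities.Theorems.PIDim4

namespace Equivariance

/-! ## §1 Unrolling a path to an image into an infinite chain -/

section Unroll

variable {α : Type*} (ρ : α → α → Prop) (g : α → α)

/-- A simulation iterates: `ρ a b → ρ (g^k a) (g^k b)`. [folklore] -/
theorem rel_iterate (hsim : ∀ a b, ρ a b → ρ (g a) (g b)) (k : ℕ) {a b : α} (h : ρ a b) :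
    ρ (g^[k] a) (g^[k] b) := by
  induction k with
  | zero => simpa using h
  | succ k ih => rw [Function.iterate_succ_apply', Function.iterate_succ_apply']; exact hsim _ _ ih

/-- A `TransGen` path as an indexed finite path. [folklore] -/
theorem exists_path_of_transGen {a b : α} (h : Relation.TransGen ρ a b) :
    ∃ (n : ℕ) (p : ℕ → α), 0 < n ∧ p 0 = a ∧ p n = b ∧ ∀ i < n, ρ (p i) (p (i + 1)) := by
  induction h with
  | @single b hab =>
    exact ⟨1, fun i => if i = 0 then a else b, Nat.one_pos, rfl, rfl, fun i hi => by
      have : i = 0 := by omega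
      subst this; simpa using hab⟩
  | @tail b c _ hbc ih =>
    obtain ⟨n, p, hn, hp0, hpn, hstep⟩ := ih
    refine ⟨n + 1, fun i => if i ≤ n then p i else c, by omega, by simp [hp0], by simp, fun i hi => ?_⟩
    by_cases hin : i < n
    · show ρ (if i ≤ n then p i else c) (if i + 1 ≤ n then p (i + 1) else c)
      rw [if_pos hin.le, if_pos (by omega)]; exact hstep i hin
    · have : i = n := by omega
      subst this
      show ρ (if i ≤ i then p i else c) (if i + 1 ≤ i then p (i + 1) else c)
      rw [if_pos le_rfl, if_neg (by omega), hpn]; exact hbc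

/-- **Unrolling**: if `ρ` is simulated by `g` and there is a path `a ⟶⁺ g a`, then there is an infinite
`ρ`-chain from `a` (lap `k` = the `g^k`-image of the path). [folklore] -/
theorem exists_chain_of_transGen_apply (hsim : ∀ a b, ρ a b → ρ (g a) (g b)) {a : α}
    (h : Relation.TransGen ρ a (g a)) : ∃ c : ℕ → α, c 0 = a ∧ ∀ m, ρ (c m) (c (m + 1)) := by
  obtain ⟨n, p, hn, hp0, hpn, hstep⟩ := exists_path_of_transGen ρ h
  refine ⟨fun m => g^[m / n] (p (m % n)), by simp [Nat.zero_div, Nat.zero_mod, hp0], fun m => ?_⟩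
  -- write `m = n * k + i` with `i < n`
  set k := m / n with hk
  set i := m % n with hi
  have hin : i < n := Nat.mod_lt _ hn
  have hm : n * k + i = m := Nat.div_add_mod m n
  by_cases hlast : i + 1 < n
  · -- inside a lap
    have h1 : (m + 1) / n = k := by
      rw [← hm, add_assoc, Nat.mul_add_div hn, Nat.div_eq_of_lt hlast, add_zero]
    have h2 : (m + 1) % n = i + 1 := by
      rw [← hm, add_assoc, Nat.mul_add_mod, Nat.mod_eq_of_lt hlast]
    show ρ (g^[m / n] (p (m % n))) (g^[(m + 1) / n] (p ((m + 1) % n)))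
    rw [h1, h2, ← hk, ← hi]
    exact rel_iterate ρ g hsim k (hstep i hin)
  · -- end of a lap: `p n = g a = g (p 0)`
    have hi1 : i + 1 = n := by omega
    have h1 : (m + 1) / n = k + 1 := by
      rw [← hm, add_assoc, hi1, ← Nat.mul_succ, Nat.mul_div_cancel_left _ hn]
    have h2 : (m + 1) % n = 0 := by
      rw [← hm, add_assoc, hi1, ← Nat.mul_succ, Nat.mul_mod_right]
    have hlap : ρ (g^[k] (p i)) (g^[k] (p n)) := by
      have := rel_iterate ρ g hsim k (hstep i hin)
      rwa [hi1] at this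
    show ρ (g^[m / n] (p (m % n))) (g^[(m + 1) / n] (p ((m + 1) % n)))
    rw [h1, h2, ← hk, ← hi, hp0, Function.iterate_succ_apply, ← hpn]
    exact hlap

/-- The literal cycle: a path `a ⟶⁺ a` unrolls into an infinite chain from `a`. [folklore] -/
theorem exists_chain_of_transGen_self {a : α} (h : Relation.TransGen ρ a a) :
    ∃ c : ℕ → α, c 0 = a ∧ ∀ m, ρ (c m) (c (m + 1)) :=
  exists_chain_of_transGen_apply ρ id (fun _ _ h => h) (by simpa using h)

end Unroll

/-! ## §2 Cell words: recurrence up to renaming refutes the termination frames -/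

section Cell

variable {K : Type} [Field K] [DecidableEq K] (e : Equiv.Perm (Fin 4))

/-- **A MODE-1h path from a state to one of its renamings unrolls into an infinite MODE-1h branch.** [folklore] -/
theorem exists_branch_of_step1h_transGen_rename {q : ℕ} {s : State K}
    (h : Relation.TransGen (Step1h q) s (s.rename e)) :
    ∃ c : ℕ → State K, c 0 = s ∧ ∀ m, Step1h q (c m) (c (m + 1)) :=
  exists_chain_of_transGen_apply (Step1h q) (State.rename e) (fun _ _ h => step1h_rename e h) h

/-- The same for MODE 0. [folklore] -/
theorem exists_branch_of_step0_transGen_rename {q : ℕ} {s : State K}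
    (h : Relation.TransGen (Step0 q) s (s.rename e)) :
    ∃ c : ℕ → State K, c 0 = s ∧ ∀ m, Step0 q (c m) (c (m + 1)) :=
  exists_chain_of_transGen_apply (Step0 q) (State.rename e) (fun _ _ h => step0_rename e h) h

/-- The same for MODE 2. [folklore] -/
theorem exists_branch_of_step2_transGen_rename {q : ℕ} {s : State K}
    (h : Relation.TransGen (Step2 q) s (s.rename e)) :
    ∃ c : ℕ → State K, c 0 = s ∧ ∀ m, Step2 q (c m) (c (m + 1)) :=
  exists_chain_of_transGen_apply (Step2 q) (State.rename e) (fun _ _ h => step2_rename e h) h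

/-- The same for HP-permissible steps. [folklore] -/
theorem exists_branch_of_stepHP_transGen_rename {q : ℕ} {s : State K}
    (h : Relation.TransGen (StepHP q) s (s.rename e)) :
    ∃ c : ℕ → State K, c 0 = s ∧ ∀ m, StepHP q (c m) (c (m + 1)) :=
  exists_chain_of_transGen_apply (StepHP q) (State.rename e) (fun _ _ h => stepHP_rename e h) h

/-- The same for an EQUIVARIANT rule. [folklore] -/
theorem exists_branch_of_stepRule_transGen_rename {q : ℕ} {R : CentreRule K} (hR : IsEquivariantRule R)
    {s : State K} (h : Relation.TransGen (StepRule q R) s (s.rename e)) :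
    ∃ c : ℕ → State K, c 0 = s ∧ ∀ m, StepRule q R (c m) (c (m + 1)) :=
  exists_chain_of_transGen_apply (StepRule q R) (State.rename e) (fun _ _ h => stepRule_rename e hR h) h

/-- **A recurrence up to renaming kills `Terminates1h`**: over one field of characteristic `p`, a MODE-1h path
`s ⟶⁺ s.rename e` refutes `Terminates1h p q` (engine B's «cycle mod S₄» is a valid certificate for the relation
of record). [folklore] -/
theorem not_terminates1h_of_transGen_rename {p q : ℕ} [CharP K p] {s : State K}
    (h : Relation.TransGen (Step1h q) s (s.rename e)) : ¬ Terminates1h p q := fun hT => by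
  obtain ⟨c, -, hc⟩ := exists_branch_of_step1h_transGen_rename e h
  exact hT K ⟨c, hc⟩

/-- The literal cycle case (`e = 1`): a MODE-1h path `s ⟶⁺ s` refutes `Terminates1h p q`. [folklore] -/
theorem not_terminates1h_of_transGen_self {p q : ℕ} [CharP K p] {s : State K}
    (h : Relation.TransGen (Step1h q) s s) : ¬ Terminates1h p q := fun hT => by
  obtain ⟨c, -, hc⟩ := exists_chain_of_transGen_self (Step1h q) h
  exact hT K ⟨c, hc⟩

/-- A recurrence up to renaming under an equivariant permissible rule kills `TerminatesUnder`. [folklore] -/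
theorem not_terminatesUnder_of_transGen_rename {q : ℕ} {R : CentreRule K} (hR : IsEquivariantRule R)
    {s : State K} (h : Relation.TransGen (StepRule q R) s (s.rename e)) : ¬ TerminatesUnder q R := fun hT => by
  obtain ⟨c, -, hc⟩ := exists_branch_of_stepRule_transGen_rename e hR h
  exact hT ⟨c, hc⟩

end Cell

end Equivariance

end Summit.ResolutionOfSingularities.ResolutionOfSingularities.Theorems.PIDim4

end
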